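import Summits.Ventures.HodgeKum4.Theorems.KummerFixedLocusL1HilbJoinSpan
import Summits.Ventures.HodgeKum4.Theorems.KummerFixedLocusL1HilbSuperLie
import HarnessLib

/-!
# Lane (V), line v2p5 — stub S-F (`stub_span`), JOIN half, part 2: polarisations relabel unit letters (J2, Fock-space form)

Cell `hodge-kum4`, crux stmt-Ventures-20306 (`LefschetzGenerationHilb5`, W-form); the cut of record (director-hodge g8 13:00:29Z,
plan g19 `SeamSF.v2.PLAN` e3a3fc3607265de7): p2 = **J2 `PolarReach`** — from the all-unit Nakajima monomials and stability under
the polarisation operators `τ_k(φ)`, `φ = b_i ⊗ b_{i₀}^∨`, a subspace contains every Nakajima monomial.  This file is the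
Fock-space (pure algebra) form over the axioms `IsHeisenbergRepresentation` (field `K` of characteristic `0`, graded-symmetric
pairing `B`, even Casimir tensor `C`), in the letter calculus of `HilbertScheme/HeisenbergMonomialSpanning`:

* `transferTerm_letterWord_polar` — **the relabelling rule, sign-free**: for a homogeneous family `x`, a unit colour `c₀`
  (`deg c₀ = 0`) and an endomorphism `φ` with `φ(x_{c₀}) = x_{c₁}`, `φ(x_c) = 0` (`c ≠ c₀`), of parity `deg c₁`:
  `τ_k(φ) (M_L |0⟩) = −k · #{j : L_j = (c₀, k)} · 𝔮_k(x_{c₁}) (M_{L ∖ (c₀,k)} |0⟩)` for EVERY word `L` of positive modes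
  (`transferTerm_superCommute_apply` of `…L1HilbSuperLie` letter by letter; the Koszul sign of passing `τ_k(φ)` through a letter
  equals the sign of moving the created letter `𝔮_k(x_{c₁})` back, so no sign survives);
* `monomialOp_vac_mem_of_polar` — the induction on the number of non-unit letters: if `Ŵ ⊆ ℍ` contains the all-unit admissible
  monomials of total mode `n` and is stable under all `τ_k(φ_c)` (`1 ≤ k ≤ n`, `c ≠ c₀`), it contains every sorted admissible
  monomial of total mode `n`; `heisenbergMonomial_mem_of_polar` — the same for the Heisenberg monomials of `ρ ∈ 𝒫ₙ`.

HONEST FRAMING: helper lemmas; nothing here asserts S-F ∕ L1-Hilb(n) ∕ L1 ∕ HC_Kum4Type ∕ HC.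
-/

noncomputable section

open DirectSum TensorProduct

universe u v w

namespace Summit.Ventures.HodgeKum4.L1Hilb.Join

open Literature.AlgebraicGeometry.HilbertScheme

variable {K : Type u} [Field K]
variable {A : ℕ → Type v} [∀ i, AddCommGroup (A i)] [∀ i, Module K (A i)]
variable {Φ : ℕ → ℕ → Type w} [∀ n i, AddCommGroup (Φ n i)] [∀ n i, Module K (Φ n i)]
variable {B : (⨁ i, A i) →ₗ[K] (⨁ i, A i) →ₗ[K] K} {q : ℤ → (⨁ i, A i) →ₗ[K] Module.End K (Fock Φ)} {vac : Fock Φ}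
variable {N : ℕ} {x : Fin N → ⨁ i, A i} {deg : Fin N → ℕ}

/-! ### 1. The transfer term on letters -/

/-- **The letter rule of a transfer term with the Casimir contraction done**: for an even Casimir tensor `C`, `φ` of parity
`p`, `k, r > 0` and a homogeneous `γ ∈ A j`:
`τ_k(φ)(𝔮_r(γ) y) = (−1)^{pj} 𝔮_r(γ)(τ_k(φ) y) − δ_{k,r} r · 𝔮_r(φ γ) y`. -/
theorem transferTerm_q_apply (h : IsHeisenbergRepresentation B q vac)
    (hB : ∀ (i j : ℕ) (a : A i) (b : A j),
      B (lof K ℕ A i a) (lof K ℕ A j b) = (-1 : K) ^ (i * j) * B (lof K ℕ A j b) (lof K ℕ A i a))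
    {C : (⨁ i, A i) ⊗[K] (⨁ i, A i)} (hCg : C ∈ evenTensorSpan K A) (hC : IsCasimir K B C)
    {p : ℕ} {φ : (⨁ i, A i) →ₗ[K] (⨁ i, A i)} (hφ : ∀ (j : ℕ) (ε : A j), φ (lof K ℕ A j ε) ∈ paritySpan K A (j + p))
    {k r : ℕ} (hk : 1 ≤ k) (hr : 1 ≤ r) {j : ℕ} (γ : A j) (y : Fock Φ) :
    transferTerm K q C φ k (q r (lof K ℕ A j γ) y) =
      ((-1 : K) ^ (p * j)) • q r (lof K ℕ A j γ) (transferTerm K q C φ k y) +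
        (if k = r then -((r : K) • q r (φ (lof K ℕ A j γ)) y) else 0) := by
  have hmain := SuperLie.transferTerm_superCommute_apply h hB hCg hφ (n := (k : ℤ)) (m := (r : ℤ))
    (by exact_mod_cast hk) (by exact_mod_cast hr) γ y
  rw [hC (lof K ℕ A j γ)] at hmain
  rw [← sub_eq_iff_eq_add'] at *
  rw [hmain]
  by_cases hkr : k = r
  · subst hkr; rw [if_pos rfl, if_pos rfl, Int.cast_natCast]
  · rw [if_neg (by exact_mod_cast hkr), if_neg hkr]

/-- **A transfer term kills the vacuum** (`τ_k(φ) = Σᵢ 𝔮_k(φεᵢ)𝔮₋ₖ(eᵢ)`: the annihilator acts first). -/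
theorem transferTerm_vac (h : IsHeisenbergRepresentation B q vac) (C : (⨁ i, A i) ⊗[K] (⨁ i, A i))
    (φ : (⨁ i, A i) →ₗ[K] (⨁ i, A i)) {k : ℤ} (hk : 0 < k) : transferTerm K q C φ k vac = 0 := by
  induction C using TensorProduct.induction_on with
  | zero => simp [transferTerm]
  | tmul e ε => rw [transferTerm_tmul, Module.End.mul_apply, h.q_apply_vac_eq_zero (by omega), map_zero]
  | add C C' hC hC' =>
    have : transferTerm K q (C + C') φ k = transferTerm K q C φ k + transferTerm K q C' φ k := by
      simp [transferTerm, map_add]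
    rw [this, LinearMap.add_apply, hC, hC', add_zero]

/-- A unit letter passes through every word of letters of positive modes: `𝔮ₐ(U) M_L = M_L 𝔮ₐ(U)`. -/
theorem q_unit_mul_monomialOp_letterWord (h : IsHeisenbergRepresentation B q vac) {U : ⨁ i, A i}
    (hU : U ∈ LinearMap.range (lof K ℕ A 0)) {a : ℕ} (ha : 1 ≤ a) {L : List (Lex (Fin N × ℕ))}
    (hL : ∀ τ ∈ L, 1 ≤ letterPart τ) :
    q (a : ℤ) U * monomialOp q (letterWord x L) = monomialOp q (letterWord x L) * q (a : ℤ) U := by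
  induction L with
  | nil => rw [letterWord_nil, monomialOp_nil, mul_one, one_mul]
  | cons τ L ih =>
    have hτ : 1 ≤ letterPart τ := hL τ List.mem_cons_self
    rw [letterWord_cons, monomialOp_cons, ← mul_assoc, q_unit_mul_q h hU (by omega), mul_assoc,
      ih fun τ' hτ' ↦ hL τ' (List.mem_cons_of_mem τ hτ'), mul_assoc]

/-- **The relabelling rule (sign-free).**  For a homogeneous family `x`, a unit colour `c₀` (`deg c₀ = 0`), a colour `c₁` and an
endomorphism `φ` of parity `deg c₁` with `φ(x_{c₀}) = x_{c₁}` and `φ(x_c) = 0` for `c ≠ c₀` (the polarisation `x_{c₁} ⊗ x_{c₀}^∨`),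
and every word `L` of letters of positive modes:
`τ_k(φ) (M_L |0⟩) = −k · (number of letters (c₀, k) in L) · 𝔮_k(x_{c₁}) (M_{L.erase (c₀, k)} |0⟩)`. -/
theorem transferTerm_letterWord_polar [CharZero K] (h : IsHeisenbergRepresentation B q vac)
    (hB : ∀ (i j : ℕ) (a : A i) (b : A j),
      B (lof K ℕ A i a) (lof K ℕ A j b) = (-1 : K) ^ (i * j) * B (lof K ℕ A j b) (lof K ℕ A i a))
    {C : (⨁ i, A i) ⊗[K] (⨁ i, A i)} (hCg : C ∈ evenTensorSpan K A) (hC : IsCasimir K B C)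
    (hx : ∀ c, x c ∈ LinearMap.range (lof K ℕ A (deg c))) {c₀ c₁ : Fin N} (hc₀ : deg c₀ = 0)
    {φ : (⨁ i, A i) →ₗ[K] (⨁ i, A i)} (hφ : ∀ (j : ℕ) (ε : A j), φ (lof K ℕ A j ε) ∈ paritySpan K A (j + deg c₁))
    (hφ₀ : φ (x c₀) = x c₁) (hφ₁ : ∀ c, c ≠ c₀ → φ (x c) = 0) {k : ℕ} (hk : 1 ≤ k)
    (L : List (Lex (Fin N × ℕ))) (hL : ∀ τ ∈ L, 1 ≤ letterPart τ) :
    transferTerm K q C φ k (monomialOp q (letterWord x L) vac) =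
      (-((k : K) * (L.count (toLex (c₀, k)) : ℕ))) •
        q (k : ℤ) (x c₁) (monomialOp q (letterWord x (L.erase (toLex (c₀, k)))) vac) := by
  have hU : x c₀ ∈ LinearMap.range (lof K ℕ A 0) := hc₀ ▸ hx c₀
  induction L with
  | nil =>
    rw [letterWord_nil, List.erase_nil, List.count_nil, monomialOp_nil, Module.End.one_apply,
      transferTerm_vac h C φ (by exact_mod_cast hk), Nat.cast_zero, mul_zero, neg_zero, zero_smul]
  | cons τ L ih =>
    have hτ : 1 ≤ letterPart τ := hL τ List.mem_cons_self
    have hL' : ∀ τ' ∈ L, 1 ≤ letterPart τ' := fun τ' hτ' ↦ hL τ' (List.mem_cons_of_mem τ hτ')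
    by_cases hτσ : τ = toLex (c₀, k)
    · -- the letter IS the unit letter `(c₀, k)`: one more relabelled term, no sign (`deg c₀ = 0`)
      subst hτσ
      obtain ⟨u, hu⟩ := hU
      rw [letterWord_cons, monomialOp_cons, Module.End.mul_apply, List.count_cons_self, List.erase_cons_head]
      change transferTerm K q C φ k (q (k : ℤ) (x c₀) (monomialOp q (letterWord x L) vac)) = _
      rw [← hu, transferTerm_q_apply h hB hCg hC hφ hk hk u _, hu, ih hL', if_pos rfl, mul_zero, pow_zero, one_smul,
        hφ₀, map_smul]
      -- `𝔮_k(x_{c₀})` passes `𝔮_k(x_{c₁})` and the word; `𝔮_k(x_{c₀}) M_{L.erase (c₀,k)} |0⟩ = M_L |0⟩` when the letter is present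
      have hU' : x c₀ ∈ LinearMap.range (lof K ℕ A 0) := ⟨u, hu⟩
      by_cases hmem : toLex (c₀, k) ∈ L
      · obtain ⟨l₁, l₂, hnot, hLeq, herase⟩ := List.exists_erase_eq hmem
        have hl₁ : ∀ τ' ∈ l₁, 1 ≤ letterPart τ' := fun τ' h' ↦ hL' τ' (hLeq ▸ List.mem_append_left (toLex (c₀, k) :: l₂) h')
        have hcomm : q (k : ℤ) (x c₀) (q (k : ℤ) (x c₁) (monomialOp q (letterWord x (L.erase (toLex (c₀, k)))) vac)) =
            q (k : ℤ) (x c₁) (monomialOp q (letterWord x L) vac) := by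
          rw [← Module.End.mul_apply, q_unit_mul_q h hU' (by omega), Module.End.mul_apply, herase]
          conv_rhs => rw [hLeq]
          rw [letterWord_append, letterWord_append, letterWord_cons, monomialOp_append, monomialOp_append,
            monomialOp_cons, Module.End.mul_apply, Module.End.mul_apply, Module.End.mul_apply, ← Module.End.mul_apply
              (q (k : ℤ) (x c₀)), q_unit_mul_monomialOp_letterWord h hU' hk hl₁, Module.End.mul_apply]
          rfl
        rw [hcomm, Nat.cast_add, Nat.cast_one, ← neg_smul, ← add_smul]
        congr 1
        ring
      · rw [List.erase_of_not_mem hmem, List.count_eq_zero.2 hmem]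
        simp only [Nat.cast_zero, mul_zero, neg_zero, zero_smul, zero_add, Nat.cast_one, mul_one, neg_smul]
    · -- a different letter: no relabelled term, and the two Koszul signs cancel
      obtain ⟨a, ha⟩ := hx (letterColour τ)
      rw [letterWord_cons, monomialOp_cons, Module.End.mul_apply, ← ha,
        transferTerm_q_apply h hB hCg hC hφ hk hτ a _, ha, ih hL']
      have hextra : (if k = letterPart τ then
          -((letterPart τ : K) • q (letterPart τ : ℤ) (φ (x (letterColour τ))) (monomialOp q (letterWord x L) vac))
          else 0) = 0 := by
        split_ifs with hkr
        · have hc : letterColour τ ≠ c₀ := by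
            intro hc
            apply hτσ
            rw [← hc, hkr]
            rfl
          rw [hφ₁ _ hc, map_zero, LinearMap.zero_apply, smul_zero, neg_zero]
        · rfl
      rw [hextra, add_zero, List.count_cons, if_neg (by simpa using hτσ), add_zero, List.erase_cons_tail
        (by simpa using fun h' ↦ hτσ h'), letterWord_cons, monomialOp_cons, Module.End.mul_apply, map_smul]
      -- swap `𝔮_r(x_τ)` and `𝔮_k(x_{c₁})`: sign `(−1)^{deg τ · deg c₁}` cancels `(−1)^{deg c₁ · deg τ}`
      obtain ⟨a₁, ha₁⟩ := hx c₁
      rw [← ha, ← ha₁, ← Module.End.mul_apply (q _ (lof K ℕ A _ a)),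
        h.mul_eq_sign_smul_mul (m := (letterPart τ : ℤ)) (l := (k : ℤ)) (by omega) _ _ a a₁,
        LinearMap.smul_apply, Module.End.mul_apply, smul_smul, smul_smul]
      congr 1
      rw [mul_comm (deg (letterColour τ)) (deg c₁), mul_comm ((-1 : K) ^ _) (-((k : K) * _)), mul_assoc, ← pow_add,
        ← two_mul, pow_mul, neg_one_sq, one_pow, mul_one]

/-! ### 2. From unit monomials to all monomials -/

/-- An odd letter of a sorted admissible word is not repeated: `(c, m) ∉ L.erase (c, m)` for `deg c` odd. -/
theorem not_mem_erase_of_odd {L : List (Lex (Fin N × ℕ))} (hL : IsAdmissibleWord deg L) {c : Fin N} (hodd : Odd (deg c))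
    (m : ℕ) : toLex (c, m) ∉ L.erase (toLex (c, m)) := by
  intro hmem
  have h2 : 2 ≤ L.count (toLex (c, m)) := by
    have h1 : 1 ≤ (L.erase (toLex (c, m))).count (toLex (c, m)) := List.count_pos_iff.2 hmem
    rw [List.count_erase_self] at h1
    omega
  have hsub : (List.replicate 2 (toLex (c, m))).Sublist L := List.replicate_sublist_iff.2 h2
  rcases List.pairwise_replicate.1 (hL.2.sublist hsub) with h | ⟨-, hne⟩
  · omega
  · exact hne hodd rfl

/-- The number of NON-unit letters (colour `≠ c₀`) of a word. -/
def nonunitCount (c₀ : Fin N) (L : List (Lex (Fin N × ℕ))) : ℕ :=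
  L.countP fun τ ↦ decide (letterColour τ ≠ c₀)

/-- **Polarisations reach every sorted admissible monomial from the unit ones** (Fock-space form of J2).  Let `Ŵ ⊆ ℍ`
contain `M_L|0⟩` for every sorted admissible ALL-UNIT word `L` (letters `(c₀, r)`) of total mode `n`, and be stable under the
transfer terms `τ_k(φ_c)` (`1 ≤ k ≤ n`, `c ≠ c₀`) of endomorphisms `φ_c` of parity `deg c` with `φ_c(x_{c₀}) = x_c`,
`φ_c(x_{c'}) = 0` (`c' ≠ c₀`).  Then `M_L|0⟩ ∈ Ŵ` for every sorted admissible word `L` of total mode `n`. -/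
theorem monomialOp_vac_mem_of_polar [CharZero K] (h : IsHeisenbergRepresentation B q vac)
    (hB : ∀ (i j : ℕ) (a : A i) (b : A j),
      B (lof K ℕ A i a) (lof K ℕ A j b) = (-1 : K) ^ (i * j) * B (lof K ℕ A j b) (lof K ℕ A i a))
    {C : (⨁ i, A i) ⊗[K] (⨁ i, A i)} (hCg : C ∈ evenTensorSpan K A) (hC : IsCasimir K B C)
    (hx : ∀ c, x c ∈ LinearMap.range (lof K ℕ A (deg c))) {c₀ : Fin N} (hc₀ : deg c₀ = 0)
    (φ : Fin N → (⨁ i, A i) →ₗ[K] (⨁ i, A i))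
    (hφ : ∀ c (j : ℕ) (ε : A j), φ c (lof K ℕ A j ε) ∈ paritySpan K A (j + deg c))
    (hφ₀ : ∀ c, φ c (x c₀) = x c) (hφ₁ : ∀ c c', c' ≠ c₀ → φ c (x c') = 0)
    {n : ℕ} (Ŵ : Submodule K (Fock Φ))
    (hunit : ∀ L : List (Lex (Fin N × ℕ)), IsAdmissibleWord deg L → wordMode (letterWord x L) = n →
      nonunitCount c₀ L = 0 → monomialOp q (letterWord x L) vac ∈ Ŵ)
    (hstable : ∀ c, c ≠ c₀ → ∀ k : ℕ, 1 ≤ k → k ≤ n → ∀ v ∈ Ŵ, transferTerm K q C (φ c) k v ∈ Ŵ)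
    (L : List (Lex (Fin N × ℕ))) (hL : IsAdmissibleWord deg L) (hn : wordMode (letterWord x L) = n) :
    monomialOp q (letterWord x L) vac ∈ Ŵ := by
  classical
  -- induction on the number of non-unit letters
  suffices key : ∀ (t : ℕ) (L : List (Lex (Fin N × ℕ))), IsAdmissibleWord deg L → wordMode (letterWord x L) = n →
      nonunitCount c₀ L = t → monomialOp q (letterWord x L) vac ∈ Ŵ from key _ L hL hn rfl
  intro t
  induction t with
  | zero => exact fun L hL hn h0 ↦ hunit L hL hn h0
  | succ t ih =>
    intro L hL hn ht
    -- a non-unit letter `σ₁ = (c₁, k)` of `L`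
    obtain ⟨σ₁, hσ₁L, hσ₁⟩ : ∃ σ₁ ∈ L, letterColour σ₁ ≠ c₀ := by
      obtain ⟨σ₁, hσ₁L, hσ₁⟩ := List.countP_pos_iff.1 (show 0 < nonunitCount c₀ L by omega)
      exact ⟨σ₁, hσ₁L, by simpa using hσ₁⟩
    set c₁ := letterColour σ₁ with hc₁
    set k := letterPart σ₁ with hk
    have hσ₁eq : σ₁ = toLex (c₁, k) := rfl
    have hk1 : 1 ≤ k := hL.1 σ₁ hσ₁L
    have hkn : k ≤ n := hn ▸ letterPart_le_wordMode x hσ₁L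
    -- the word `L⁻ = L.erase σ₁` and the word `L'` = sorted insertion of the unit letter `(c₀, k)` into `L⁻`
    set L₀ := L.erase σ₁ with hL₀
    have hL₀adm : IsAdmissibleWord deg L₀ := hL.sublist (List.erase_sublist ..)
    have hL₀parts : ∀ τ ∈ L₀, 1 ≤ letterPart τ := hL₀adm.1
    rcases q_letter_apply_eq h two_ne_zero hx hk1 c₀ hL₀adm with ⟨hodd, -, -⟩ | ⟨hL'adm, hL'eq⟩
    · exact absurd hodd (by rw [hc₀]; exact Nat.not_odd_zero)
    set P := L₀.takeWhile (fun τ ↦ decide (τ < toLex (c₀, k))) with hP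
    set S := L₀.dropWhile (fun τ ↦ decide (τ < toLex (c₀, k))) with hS
    set L' := P ++ toLex (c₀, k) :: S with hL'def
    have hPS : P ++ S = L₀ := List.takeWhile_append_dropWhile
    have hσ₀P : toLex (c₀, k) ∉ P := fun hmem ↦ by
      have := List.mem_takeWhile_imp hmem
      simp at this
    -- bookkeeping of `L'`
    have hL'erase : L'.erase (toLex (c₀, k)) = L₀ := by
      rw [hL'def, List.erase_append_right _ hσ₀P, List.erase_cons_head, hPS]
    have hL'count : 1 ≤ L'.count (toLex (c₀, k)) :=
      List.count_pos_iff.2 (List.mem_append_right P List.mem_cons_self)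
    have hL'mode : wordMode (letterWord x L') = n := by
      have h1 : wordMode (letterWord x L') = k + wordMode (letterWord x L₀) := by
        rw [hL'def, ← hPS, letterWord_append, letterWord_append, letterWord_cons, wordMode_append, wordMode_append,
          wordMode_cons, letterPart_toLex]
        ring
      have h2 : wordMode (letterWord x L) = k + wordMode (letterWord x L₀) := by
        have hperm := List.perm_cons_erase hσ₁L
        rw [wordMode_letterWord, wordMode_letterWord, (hperm.map letterPart).sum_eq, List.map_cons, List.sum_cons]
      omega
    have hL'nonunit : nonunitCount c₀ L' = t := by
      have h1 : nonunitCount c₀ L' = nonunitCount c₀ L₀ := by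
        rw [nonunitCount, nonunitCount, hL'def, ← hPS, List.countP_append, List.countP_append, List.countP_cons,
          letterColour_toLex]
        simp
      have h2 : nonunitCount c₀ L = nonunitCount c₀ L₀ + 1 := by
        rw [nonunitCount, nonunitCount, (List.perm_cons_erase hσ₁L).countP_eq, List.countP_cons, if_pos (by simpa using hσ₁)]
      omega
    -- induction hypothesis: `M_{L'}|0⟩ ∈ Ŵ`; apply the polarisation `τ_k(φ_{c₁})`
    have hmem' : monomialOp q (letterWord x L') vac ∈ Ŵ := ih L' hL'adm hL'mode hL'nonunit
    have hT := hstable c₁ hσ₁ k hk1 hkn _ hmem'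
    rw [transferTerm_letterWord_polar h hB hCg hC hx hc₀ (hφ c₁) (hφ₀ c₁) (hφ₁ c₁) hk1 L' hL'adm.1, hL'erase] at hT
    -- `𝔮_k(x_{c₁}) M_{L⁻}|0⟩ = ± M_L|0⟩` (sorted insertion puts `σ₁` back)
    rcases q_letter_apply_eq h two_ne_zero hx hk1 c₁ hL₀adm with ⟨hodd, hmem, -⟩ | ⟨hL''adm, hL''eq⟩
    · exact absurd hmem (hσ₁eq ▸ not_mem_erase_of_odd hL hodd k)
    set P₁ := L₀.takeWhile (fun τ ↦ decide (τ < toLex (c₁, k))) with hP₁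
    set S₁ := L₀.dropWhile (fun τ ↦ decide (τ < toLex (c₁, k))) with hS₁
    have hback : P₁ ++ toLex (c₁, k) :: S₁ = L := by
      refine List.Perm.eq_of_pairwise' hL''adm.pairwise_le hL.pairwise_le ?_
      have hPS₁ : P₁ ++ S₁ = L₀ := List.takeWhile_append_dropWhile
      have h1 : List.Perm (P₁ ++ toLex (c₁, k) :: S₁) (toLex (c₁, k) :: (P₁ ++ S₁)) := List.perm_middle
      rw [hPS₁] at h1
      exact h1.trans (List.perm_cons_erase hσ₁L).symm
    rw [hback] at hL''eq
    rw [hL''eq, smul_smul] at hT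
    -- the coefficient is a unit
    have hcoef : (-((k : K) * (L'.count (toLex (c₀, k)) : ℕ))) * (-1 : K) ^ (deg c₁ * letterDegSum deg P₁) ≠ 0 := by
      refine mul_ne_zero (neg_ne_zero.2 (mul_ne_zero ?_ ?_)) (pow_ne_zero _ (neg_ne_zero.2 one_ne_zero))
      · exact_mod_cast (show k ≠ 0 by omega)
      · exact_mod_cast (show L'.count (toLex (c₀, k)) ≠ 0 by omega)
    exact (Submodule.smul_mem_iff Ŵ hcoef).1 hT

/-- **J2, Fock-space form: polarisations reach every Heisenberg monomial.**  Under the hypotheses of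
`monomialOp_vac_mem_of_polar`, with the unit monomials given as the Heisenberg monomials of the partition-valued functions
supported on the unit colour `c₀`: `Π_c 𝔞_{−ρ(c)}(x_c)|0⟩ ∈ Ŵ` for every `ρ ∈ 𝒫ₙ`. -/
theorem heisenbergMonomial_mem_of_polar [CharZero K] (h : IsHeisenbergRepresentation B q vac)
    (hB : ∀ (i j : ℕ) (a : A i) (b : A j),
      B (lof K ℕ A i a) (lof K ℕ A j b) = (-1 : K) ^ (i * j) * B (lof K ℕ A j b) (lof K ℕ A i a))
    {C : (⨁ i, A i) ⊗[K] (⨁ i, A i)} (hCg : C ∈ evenTensorSpan K A) (hC : IsCasimir K B C)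
    (hx : ∀ c, x c ∈ LinearMap.range (lof K ℕ A (deg c))) {c₀ : Fin N} (hc₀ : deg c₀ = 0)
    (φ : Fin N → (⨁ i, A i) →ₗ[K] (⨁ i, A i))
    (hφ : ∀ c (j : ℕ) (ε : A j), φ c (lof K ℕ A j ε) ∈ paritySpan K A (j + deg c))
    (hφ₀ : ∀ c, φ c (x c₀) = x c) (hφ₁ : ∀ c c', c' ≠ c₀ → φ c (x c') = 0)
    {n : ℕ} (Ŵ : Submodule K (Fock Φ))
    (hunit : ∀ ρ : Fin N → Fin (n + 1) → ℕ, IsPartitionValued deg n ρ → (∀ c, c ≠ c₀ → ∀ r, ρ c r = 0) →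
      heisenbergMonomial q vac x n ρ ∈ Ŵ)
    (hstable : ∀ c, c ≠ c₀ → ∀ k : ℕ, 1 ≤ k → k ≤ n → ∀ v ∈ Ŵ, transferTerm K q C (φ c) k v ∈ Ŵ)
    {ρ : Fin N → Fin (n + 1) → ℕ} (hρ : IsPartitionValued deg n ρ) :
    heisenbergMonomial q vac x n ρ ∈ Ŵ := by
  classical
  have hmode : wordMode (letterWord x (canonList n ρ)) = n := by
    rw [letterWord_canonList, wordMode_pvWord, hρ.2.2]
  rw [heisenbergMonomial, ← letterWord_canonList]
  refine monomialOp_vac_mem_of_polar h hB hCg hC hx hc₀ φ hφ hφ₀ hφ₁ Ŵ (fun L hL hLn hL0 ↦ ?_) hstable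
    (canonList n ρ) (isAdmissibleWord_canonList hρ) hmode
  -- an all-unit admissible word is the canonical word of a unit-supported partition-valued function
  rw [← heisenbergMonomial_countFn q vac x hL hLn]
  refine hunit _ (isPartitionValued_countFn x hL hLn) fun c hc r ↦ List.count_eq_zero.2 fun hmem ↦ ?_
  have := List.countP_eq_zero.1 hL0 _ hmem
  simp [letterColour_toLex, hc] at this

end Summit.Ventures.HodgeKum4.L1Hilb.Join

end
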